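import Summits.CriticalPhenomena.SAWScalingLimit.Theses.SAWTipEnvironment
import Literature.Probability.RandomPlanarGeometry.HullSubdomainPullback

/-!
# Line `birth` — registered skeleton for the crux `KappaPin` (stmt-CriticalPhenomena-16040)

Crux (FIXED; rank 5 of `route-CriticalPhenomena-SAWTipEnvironment`, decl
`Summit.CriticalPhenomena.SAWScalingLimit.Theses.SAWTipEnvironment.KappaPin`): for every Dobrushin domain
`(D; a, b)`, every endpoint approximation `(a_δ, b_δ)`, every probability subsequential limit law `ν` of the
critical `δℤ²` SAW curve laws of `(D; a_δ, b_δ)` (`IsSubseqLimitLaw`) and every `κ > 0`: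
`IsSLELaw κ D ν → κ = 8/3`. The route text names the mechanism: "the lattice-exact two-sided restriction
identity passes to `ν` and chordal SLE_κ has the restriction property iff `κ = 8/3` (LSW03)".

## Why the cut looks the way it does (the crux is POINTWISE in `(D, ν)`)

The hypotheses hand us ONE subsequential limit `ν` in ONE marked domain which happens to be an SLE_κ law.
Every structure obtainable from `ν` by the two soft passages the lattice offers inside `D` — restriction to
hull subdomains `D' ⊆ D` (conditioning on `{γ ⊆ cl D'}`) and the domain Markov property (conditioning on a
past) — is AUTOMATICALLY consistent for every `κ ≤ 4` (for `ν = SLE_κ^D` the conditioned laws are the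
`SLE_κ^{D'}` laws tilted by `exp(−(c/2)Λ_D(γ, D ∖ D'))`, a restriction-Markov consistent assignment on all
descendants of `(D; a, b)` for every central charge `c(κ)`). So no amount of passage-to-the-limit applied to
`ν` alone can pin `κ`: the pin needs FRESH lattice input carrying conformal content, exactly as the three
grounders recorded (LSW04 arXiv:math/0204277 p. 17: the conditional "if the SAW scaling limit exists and is
conformally covariant then it is SLE_{8/3}" was never made a theorem; print pins `κ` only at family level).
The line therefore isolates that input in the cleanest scalar form print offers — LSW04 §4.1's prediction
that `m^#_saw` is an `(a)`-restriction family, read on AVOIDANCE PROBABILITIES: the probability that the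
critical SAW of `(D_δ; a_δ, b_δ)` avoids the closed hull `cl(D ∖ D')` converges, as `δ → 0⁺`, to
`Φ'_A(0)^α` (`A` = the pulled-back `*`-hull of `D'` under a chordal uniformizer `φ`, `Φ_A` its restriction
map; equivalently, by the exact lattice restriction identity `SAW.law_mul_law_setOf_exists_support_eq_le`,
ratios of critical partition functions `Z_{D'_δ}(a_δ,b_δ)/Z_{D_δ}(a_δ,b_δ) → Φ'_A(0)^α`). Everything else is
provable now or known SLE theory:

* S1 `stub_avoidanceExponent` (LATTICE, HARDEST, open) — **hull-avoidance probabilities of the critical SAW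
  have a restriction exponent**: for every `(D; a, b)` and endpoint approximation there is `α : ℝ` such that
  for every hull subdomain `D'` (`MarkedDomain.IsHullSubdomain`), chordal uniformizing `φ : ℍ → D`,
  restriction map `Φ` of `A = φ.pullbackHull D'` and `d = Φ'_A(0)` (`HasRestrictionDeriv`),
  `P_δ[curve ⊆ (cl(D ∖ D'))ᶜ] → d^α` along `𝓝[>] 0`. Consistent as a statement: `d` depends on `(D, D')`
  only (two uniformizers differ by a dilation, `Φ_{A/λ}(z) = Φ_A(λz)/λ`; `A ∈ 𝒬*` by
  `IsStarHull.pullbackHull`, so `d ∈ (0,1]` is unique, `HasRestrictionDeriv.unique`). Implied by the summit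
  conjunct with `α = 5/8` ([LSW03] Thm. 6.1 `sle_restriction_eightThirds_holds`, PROVED, transported by
  `HullSubdomainPullback`; the avoidance event is an SLE_{8/3}-continuity set by `HullRestrictionNull`).
  This is where the isotropy of `ℤ²` is spent (barrier `EmbeddingModulusUniqueness`: on a sheared lattice the
  same combinatorial probabilities cannot converge to a function of the conformal invariant `d`).
* S2 `stub_sandwichPassage` (generic portmanteau, PROVABLE NOW, size M) — for a probability subsequential
  limit `ν` of the SAW curve laws of `(Ω; a_δ, b_δ)`, open `O ⊆` closed `C ⊆ ℂ`, and `L`: if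
  `P_δ[curve ⊆ O] → L` along `𝓝[>] 0` then `ν{range ⊆ O} ≤ L ≤ ν{range ⊆ C}`. Proof: along the sequence
  `s` of `IsSubseqLimitLaw` the laws are eventually probability measures
  (`Negative.eventually_isProbabilityMeasure_of_tendsto`, Theorems/SubseqIdentification/Negative/Necessity),
  `{range ⊆ O}` is open (`CurveClass.isOpen_rangeSubset`), `{range ⊆ C}` closed
  (`CurveClass.isClosed_rangeSubset`), and Mathlib's portmanteau gives `ν(open) ≤ liminf`,
  `limsup(closed) ≤ ν(closed)`, with `P_δ[⊆ O] ≤ P_δ[⊆ C]`.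
* S3 `stub_slePin` (SLE side, size L–XL, TRUE) — **the sandwiched restriction formula pins `κ`**: if `ν` is
  an SLE_κ law of `(D; a, b)` (`κ > 0`) and for some `α` and EVERY hull datum `(D', φ, Φ, d)` of `D`,
  `ν{range ⊆ (cl(D∖D'))ᶜ} ≤ d^α ≤ ν{range ⊆ (D ∖ cl D')ᶜ}`, then `κ = 8/3`. Plan: `κ ≥ 8` — the trace is
  space-filling (`ae_isSpaceFilling_sleTrace_of_hasSLETrace_apply`, `IsSLELaw.hasSLETrace`), so the right
  event is null for a fat hull while `d^α > 0`; `4 < κ < 8` — shrink hulls onto a boundary arc: `d → 1`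
  ([LSW03] Lemma 3.5, `HasRestrictionDeriv.tendsto_of_kernel`) forces the trace to miss every boundary arc,
  against swallowing of real points (`ae_exists_swallowingTime_eq_of_pos`, SLESwallowedRealPoints); `κ ≤ 4` —
  the two events differ by touching `∂(D ∖ D')` without entering, null for simple boundary-avoiding SLE
  (strong Markov at the touching time + Blumenthal: the image of the hull interior is a wedge at the tip),
  so `P[sleTrace κ avoids A] = Φ'_A(0)^α` for all `A ∈ 𝒬*` arising as pull-backs (all smooth hulls; all of
  `𝒬*` by `RestrictionContinuity`), and [LSW03] Prop. 5.3 / Cor. 8.6 (`sle_restrictionFormula_only_eightThirds`,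
  vendored as a named fact for this very item, p119287; general-`κ` restriction martingales
  `SLERestrictionMartingaleKappa*`, `thm65_printed`) leave only `κ = 8/3`.

`KappaPin_of` (kernel-checked, no `sorry` of its own): take `α` from S1 at `(D, a, b)`; for each hull datum
S2 turns S1's limit into the sandwich (the open avoid-the-closed-hull event sits inside the closed
do-not-enter-the-open-set event because `D ∖ cl D' ⊆ cl(D ∖ D')`); S3 concludes `κ = 8/3`. Hypotheses =
the three stubs under their registered names; conclusion = the route decl BY NAME.

What the cut buys and what it bets. S2 is landable now; S3 is known mathematics with one formalization debt
(the LSW03 converse, whose Itô machinery for general `κ` is in the tree); ALL open difficulty sits in S1, by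
name, as a scalar limit statement about critical SAW partition-function ratios — the meeting point of the
lattice and the conformal side, a generalisation of the corridor target `SAWTowerCount.CorridorMassFiveEighths`
(stmt-7255's `X₀`) from rectangles to all hull pairs, and reusable by every restriction-based SAW route
(`ExponentIdentifies`, `RestrictionOfLimit`, `AxiomsOfLimit`). The cut is SUFFICIENT, not an equivalence:
S1 is family-level (all endpoint approximations, full filter) while the crux is pointwise; the bet — forced
by the consistency observation above — is that no proof of the pointwise crux avoids a family-level
conformal input. Recorded for the route's planner (grounder g51-5's note, 2026-08-16): the route's `closes`
only needs the family-level pin; a restatement `KappaPin'` would let S1 be replaced by the route's own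
`MartingaleCorrector → CorrectorPassage → DrivingIdentification` chain.

Costume / shredding check: no stub mentions `KappaPin`, `SAWScalingLimit` or `ConvergesInLawToSLE`; S1
mentions neither `ν` nor `IsSLELaw` (pure lattice limit), S2 is model-free portmanteau bookkeeping, S3 is
pure SLE; none implies the crux or the conjunct by `exact? | simpa | aesop` (BC3 probes, line card).
Disproof used: none — `ledger crux ls stmt-CriticalPhenomena-16040` shows no `Disproof.lean`, no dead lines
(2026-08-17). Negatives index (11 entries): the refuted ALL-`δ` tightness stmt-0772 is not approached (every
lattice quantity enters through a limit along `𝓝[>] 0`); no avoidance / restriction-exponent statement is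
listed. Inputs PROVED in the tree, to be used by name, not re-stubbed: `sle_restriction_eightThirds_holds`,
`IsSLELaw.hullRestriction_eightThirds_holds`, `MarkedDomain.exists_isChordalUniformizing_holds`,
`IsStarHull.pullbackHull`, `IsStarHull.existsUnique_isRestrictionMap_holds`,
`IsStarHull.exists_hasRestrictionDeriv_holds`, `CurveClass.isOpen_rangeSubset`,
`CurveClass.isClosed_rangeSubset`, `Negative.isProbabilityMeasure_law_or_eq_zero`,
`Negative.eventually_isProbabilityMeasure_of_tendsto`, `IsSLELaw.hasSLETrace`,
`ae_isSpaceFilling_sleTrace_of_hasSLETrace_apply`.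
-/

noncomputable section

open MeasureTheory Filter Topology Set
open UpperHalfPlane (upperHalfPlaneSet)
open scoped NNReal ENNReal
open Literature.Probability.RandomPlanarGeometry Literature.Probability.LatticeModels

namespace Summit.CriticalPhenomena.SAWScalingLimit.Cruxes.KappaPin.Birth

/-! ### Vocabulary of the line: the three statements, named -/

/-- **S1, named.** Hull-avoidance probabilities of the critical SAW have a restriction exponent: for every
`(D; a, b)` and endpoint approximation there is `α` with `P_δ[curve ⊆ (cl(D ∖ D'))ᶜ] → Φ'_A(0)^α` along
`δ → 0⁺` for every hull subdomain `D'`, `A` its pulled-back hull under a chordal uniformizer (LSW04 §4.1: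
"`m^#_saw` is conjectured to be an `(a)`-restriction family", avoidance-probability sector). -/
def AvoidanceExponent : Prop :=
  ∀ (D : DobrushinDomain) (a b : ℝ → Site 2), SAW.IsEndpointApprox D a b → ∃ α : ℝ,
    ∀ (D' : DobrushinDomain) (φ : ConformalEquiv upperHalfPlaneSet D.carrier)
      (Φ : ConformalEquiv (upperHalfPlaneSet \ φ.pullbackHull D') upperHalfPlaneSet) (d : ℝ),
      D.IsChordalUniformizing φ → D.IsHullSubdomain D' →
      IsRestrictionMap (φ.pullbackHull D') Φ → HasRestrictionDeriv (φ.pullbackHull D') Φ d →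
        Tendsto (fun δ : ℝ => SAW.law D.carrier δ (a δ) (b δ)
            ((fun γ : SAW.DomainSAW D.carrier δ (a δ) (b δ) => γ.curve) ⁻¹'
              CurveClass.rangeSubset (closure (D.carrier \ D'.carrier))ᶜ))
          (𝓝[>] (0 : ℝ)) (𝓝 (ENNReal.ofReal (d ^ α)))

/-- **S2, named.** Portmanteau sandwich for subsequential limits of the SAW curve laws: a limit `L` of
`P_δ[curve ⊆ O]` (`O` open) is squeezed between `ν{range ⊆ O}` and `ν{range ⊆ C}` for every closed
`C ⊇ O`. -/
def SandwichPassage : Prop :=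
  ∀ (Ω : Set ℂ) (a b : ℝ → Site 2) (ν : Measure (CurveClass ℂ)), IsProbabilityMeasure ν →
    IsSubseqLimitLaw (fun δ (γ : SAW.DomainSAW Ω δ (a δ) (b δ)) => γ.curve)
      (fun δ => SAW.law Ω δ (a δ) (b δ)) ν →
    ∀ (O C : Set ℂ), IsOpen O → IsClosed C → O ⊆ C → ∀ L : ℝ≥0∞,
      Tendsto (fun δ : ℝ => SAW.law Ω δ (a δ) (b δ)
          ((fun γ : SAW.DomainSAW Ω δ (a δ) (b δ) => γ.curve) ⁻¹' CurveClass.rangeSubset O))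
        (𝓝[>] (0 : ℝ)) (𝓝 L) →
      ν (CurveClass.rangeSubset O) ≤ L ∧ L ≤ ν (CurveClass.rangeSubset C)

/-- **S3, named.** The sandwiched restriction formula over all hull subdomains pins an SLE_κ law to
`κ = 8/3` ([LSW03] Prop. 5.3 / Cor. 8.6 for `κ ≤ 4`; swallowing of real points for `4 < κ < 8`;
space-filling for `κ ≥ 8`). -/
def SLEPin : Prop :=
  ∀ (κ : ℝ≥0) (D : DobrushinDomain) (ν : Measure (CurveClass ℂ)), 0 < κ → IsProbabilityMeasure ν →
    IsSLELaw κ D ν →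
    (∃ α : ℝ, ∀ (D' : DobrushinDomain) (φ : ConformalEquiv upperHalfPlaneSet D.carrier)
      (Φ : ConformalEquiv (upperHalfPlaneSet \ φ.pullbackHull D') upperHalfPlaneSet) (d : ℝ),
      D.IsChordalUniformizing φ → D.IsHullSubdomain D' →
      IsRestrictionMap (φ.pullbackHull D') Φ → HasRestrictionDeriv (φ.pullbackHull D') Φ d →
        ν (CurveClass.rangeSubset (closure (D.carrier \ D'.carrier))ᶜ) ≤ ENNReal.ofReal (d ^ α) ∧
          ENNReal.ofReal (d ^ α) ≤ ν (CurveClass.rangeSubset (D.carrier \ closure D'.carrier)ᶜ)) →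
    κ = 8 / 3

/-! ### The stubs (the ONLY `sorry`s of this file)

Each stub is stated over TREE VOCABULARY ONLY (the named statements above, unfolded by hand), so that it
lands verbatim as `Theorems/SAWTipEnvironmentKappaPin<Stub>.lean --supports stmt-CriticalPhenomena-16040`
without importing this workfile; the `*_holds` theorems below certify definitionally that the unfolded text
IS the named statement. Provers need
`open MeasureTheory Filter Topology Set Literature.Probability.RandomPlanarGeometry Literature.Probability.LatticeModels`,
`open UpperHalfPlane (upperHalfPlaneSet)` and `open scoped NNReal ENNReal` for the text to elaborate verbatim. -/

/-- **S1 (hardest) — hull-avoidance probabilities of the critical SAW have a restriction exponent**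
(LSW04 arXiv:math/0204277 §4.1 Prediction 1 / §2.1 Thm. 1, avoidance-probability sector; the corridor
special case is `SAWTowerCount.CorridorMassFiveEighths`). For every Dobrushin domain `(D; a, b)` and
endpoint approximation `(a_δ, b_δ)` there is an exponent `α` (predicted `5/8`) such that for every hull
subdomain `D'` of `D` (same marked points, `D ∖ D'` away from `a`, `b`), every chordal uniformizing map
`φ : (ℍ; 0, ∞) → (D; a, b)`, every restriction map `Φ = Φ_A` of the pulled-back `*`-hull
`A = closure (ℍ ∖ φ⁻¹ D')` and `d = Φ'_A(0)`, the `SAW.law`-probability that the polyline of the walk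
avoids the closed hull `closure (D ∖ D')` tends to `d ^ α` as `δ → 0⁺`. By the exact lattice restriction
identity (`SAW.law_mul_law_setOf_exists_support_eq_le`, LSW04 §3.4.5) this is the convergence of ratios of
critical partition functions `Z_{D'_δ}(a_δ,b_δ)/Z_{D_δ}(a_δ,b_δ)` up to a thin layer; the limit value
depends on `(D, D')` only (uniformizers differ by dilations; `d` is unique for `A ∈ 𝒬*`,
`IsStarHull.pullbackHull`, `HasRestrictionDeriv.unique`). Implied by the conjunct with `α = 5/8`
(`sle_restriction_eightThirds_holds` + `HullRestrictionNull`). -/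
theorem stub_avoidanceExponent :
    ∀ (D : DobrushinDomain) (a b : ℝ → Site 2), SAW.IsEndpointApprox D a b → ∃ α : ℝ,
      ∀ (D' : DobrushinDomain) (φ : ConformalEquiv upperHalfPlaneSet D.carrier)
        (Φ : ConformalEquiv (upperHalfPlaneSet \ φ.pullbackHull D') upperHalfPlaneSet) (d : ℝ),
        D.IsChordalUniformizing φ → D.IsHullSubdomain D' →
        IsRestrictionMap (φ.pullbackHull D') Φ → HasRestrictionDeriv (φ.pullbackHull D') Φ d →
          Tendsto (fun δ : ℝ => SAW.law D.carrier δ (a δ) (b δ)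
              ((fun γ : SAW.DomainSAW D.carrier δ (a δ) (b δ) => γ.curve) ⁻¹'
                CurveClass.rangeSubset (closure (D.carrier \ D'.carrier))ᶜ))
            (𝓝[>] (0 : ℝ)) (𝓝 (ENNReal.ofReal (d ^ α))) := by
  sorry

/-- **S2 — portmanteau sandwich for subsequential limits of the SAW curve laws** (generic, provable
now). If `ν` is a probability subsequential limit law of the pushed SAW laws of `(Ω; a_δ, b_δ)`
(`IsSubseqLimitLaw`: along some `s n → 0⁺`, for all bounded continuous test functions), `O ⊆ C ⊆ ℂ` with
`O` open and `C` closed, and `P_δ[curve ⊆ O] → L` along `𝓝[>] 0`, then `ν{range ⊆ O} ≤ L ≤ ν{range ⊆ C}`.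
Proof plan: compose the limit with `s`; the laws along `s` are eventually probability measures (test
function `1`, `Negative.eventually_isProbabilityMeasure_of_tendsto` / `isProbabilityMeasure_law_or_eq_zero`);
`CurveClass.rangeSubset O` is open (`CurveClass.isOpen_rangeSubset`) and `rangeSubset C` closed
(`CurveClass.isClosed_rangeSubset`), `rangeSubset O ⊆ rangeSubset C`; weak convergence of the push-forward
probability measures (`ProbabilityMeasure.tendsto_iff_forall_integral_tendsto`, `integral_map`) and
Mathlib's portmanteau (`ProbabilityMeasure.le_liminf_measure_open_of_tendsto`,
`ProbabilityMeasure.limsup_measure_closed_le_of_tendsto`) give both inequalities. -/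
theorem stub_sandwichPassage :
    ∀ (Ω : Set ℂ) (a b : ℝ → Site 2) (ν : Measure (CurveClass ℂ)), IsProbabilityMeasure ν →
      IsSubseqLimitLaw (fun δ (γ : SAW.DomainSAW Ω δ (a δ) (b δ)) => γ.curve)
        (fun δ => SAW.law Ω δ (a δ) (b δ)) ν →
      ∀ (O C : Set ℂ), IsOpen O → IsClosed C → O ⊆ C → ∀ L : ℝ≥0∞,
        Tendsto (fun δ : ℝ => SAW.law Ω δ (a δ) (b δ)
            ((fun γ : SAW.DomainSAW Ω δ (a δ) (b δ) => γ.curve) ⁻¹' CurveClass.rangeSubset O))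
          (𝓝[>] (0 : ℝ)) (𝓝 L) →
        ν (CurveClass.rangeSubset O) ≤ L ∧ L ≤ ν (CurveClass.rangeSubset C) := by
  sorry

/-- **S3 — the sandwiched restriction formula over all hull subdomains pins `κ = 8/3`** (SLE theory only;
TRUE for every `κ > 0`). Let `ν` be a chordal SLE_κ law of `(D; a, b)` and suppose that for some `α : ℝ`
and every hull datum — hull subdomain `D'`, chordal uniformizing `φ`, restriction map `Φ` of
`A = φ.pullbackHull D'`, `d = Φ'_A(0)` — the avoidance probabilities are sandwiched:
`ν{range ⊆ (cl(D ∖ D'))ᶜ} ≤ d^α ≤ ν{range ⊆ (D ∖ cl D')ᶜ}`. Then `κ = 8/3`. Plan: `κ ≥ 8`: the SLE trace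
is a.s. space-filling (`ae_isSpaceFilling_sleTrace_of_hasSLETrace_apply` with `IsSLELaw.hasSLETrace`), so
for a hull with non-empty interior the right-hand event is `ν`-null while `d ∈ (0,1]` gives `d^α > 0`.
`4 < κ < 8`: `α ≤ 0` is excluded by a fat hull (`d < 1`, and the trace enters it with positive probability);
for `α > 0` shrink smooth hulls onto a boundary arc away from `a`, `b`: `d → 1` (Carathéodory kernel
convergence, [LSW03] Lemma 3.5, `HasRestrictionDeriv.tendsto_of_kernel`), so the trace misses the arc a.s.,
contradicting swallowing of real points (`ae_exists_swallowingTime_eq_of_pos` / `_of_neg`,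
SLESwallowedRealPoints). `κ ≤ 4`: the trace is simple and meets `∂D` only at `a`, `b`; touching
`∂(D ∖ D') ∩ D` without entering `D ∖ cl D'` is null (strong Markov at the touching time: under the slit map
the hull interior contains a wedge at the tip, entered immediately a.s.), so both sides agree and, pulled
back by `φ`, `P[range (sleTrace κ) ∩ A = ∅] = Φ'_A(0)^α` for every `A ∈ 𝒬*` that is a pull-back (all
smooth hulls; all of `𝒬*` by `RestrictionContinuity` / `HullApproximation`); [LSW03] Prop. 5.3 with Cor. 8.6
(named fact `sle_restrictionFormula_only_eightThirds`, to be proved from the tree's general-`κ` restriction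
martingales `SLERestrictionMartingaleKappa*` / `thm65_printed`) leaves `κ = 8/3`. -/
theorem stub_slePin :
    ∀ (κ : ℝ≥0) (D : DobrushinDomain) (ν : Measure (CurveClass ℂ)), 0 < κ → IsProbabilityMeasure ν →
      IsSLELaw κ D ν →
      (∃ α : ℝ, ∀ (D' : DobrushinDomain) (φ : ConformalEquiv upperHalfPlaneSet D.carrier)
        (Φ : ConformalEquiv (upperHalfPlaneSet \ φ.pullbackHull D') upperHalfPlaneSet) (d : ℝ),
        D.IsChordalUniformizing φ → D.IsHullSubdomain D' →
        IsRestrictionMap (φ.pullbackHull D') Φ → HasRestrictionDeriv (φ.pullbackHull D') Φ d →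
          ν (CurveClass.rangeSubset (closure (D.carrier \ D'.carrier))ᶜ) ≤ ENNReal.ofReal (d ^ α) ∧
            ENNReal.ofReal (d ^ α) ≤
              ν (CurveClass.rangeSubset (D.carrier \ closure D'.carrier)ᶜ)) →
      κ = 8 / 3 := by
  sorry

/-! ### Consistency: each named statement IS its registered stub (definitionally) -/

theorem avoidanceExponent_holds : AvoidanceExponent := stub_avoidanceExponent
theorem sandwichPassage_holds : SandwichPassage := stub_sandwichPassage
theorem slePin_holds : SLEPin := stub_slePin

/-! ### Name-keyed aliases of the three statements — the hypotheses of `KappaPin_of`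

The native skeleton audit (`#h21_check_skeleton`) admits a hypothesis of the skeleton theorem only if its head
constant is a registered obligation or is NAMED like a declared stub; `__Registered.stub_X` is the statement of
`stub_X` under that name (device of `Cruxes/AxiomsOfLimit/Lines/birth.lean`; the `__` namespace is an
implementation detail, so the audit's stub report resolves each `stub_…` to the sorried theorem, not to the
alias; the gate-reserved `@[stub]` attribute is not written by a planner). Each alias is `rfl`-equal to its
statement. -/
namespace __Registered

/-- Alias of `AvoidanceExponent` keyed by the registered stub name. -/
abbrev stub_avoidanceExponent : Prop := AvoidanceExponent
/-- Alias of `SandwichPassage` keyed by the registered stub name. -/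
abbrev stub_sandwichPassage : Prop := SandwichPassage
/-- Alias of `SLEPin` keyed by the registered stub name. -/
abbrev stub_slePin : Prop := SLEPin

end __Registered

/-! ### The skeleton theorem: the three stubs imply the crux, BY NAME -/

/-- The open avoid-the-closed-hull event sits inside the closed do-not-enter-the-open-set event:
`(cl(D ∖ D'))ᶜ ⊆ (D ∖ cl D')ᶜ`, because `D ∖ cl D' ⊆ D ∖ D' ⊆ cl(D ∖ D')`. [folklore] -/
theorem compl_closure_diff_subset (S T : Set ℂ) : (closure (S \ T))ᶜ ⊆ (S \ closure T)ᶜ :=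
  Set.compl_subset_compl.2 fun _ hz => subset_closure ⟨hz.1, fun hzT => hz.2 (subset_closure hzT)⟩

/-- **`KappaPin` from the line `birth`** (kernel-checked, no `sorry` of its own): fix the data of the
crux; S1 at `(D, a, b)` gives the exponent `α`; for every hull datum `(D', φ, Φ, d)` S2 — fed S1's limit,
the open set `(cl(D ∖ D'))ᶜ`, the closed set `(D ∖ cl D')ᶜ` and their inclusion — gives the sandwich
`ν{range ⊆ (cl(D∖D'))ᶜ} ≤ d^α ≤ ν{range ⊆ (D ∖ cl D')ᶜ}`; S3 pins `κ = 8/3`. Hypotheses = the three stubs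
under their registered names; conclusion = the route decl, by name. -/
theorem KappaPin_of (hA : __Registered.stub_avoidanceExponent)
    (hB : __Registered.stub_sandwichPassage) (hC : __Registered.stub_slePin) :
    Summit.CriticalPhenomena.SAWScalingLimit.Theses.SAWTipEnvironment.KappaPin := by
  intro D a b hab ν hν hsub κ hκ hsle
  obtain ⟨α, hα⟩ := hA D a b hab
  refine hC κ D ν hκ hν hsle ⟨α, fun D' φ Φ d hφ hD' hΦ hd => ?_⟩
  have hlim := hα D' φ Φ d hφ hD' hΦ hd
  have hO : IsOpen (closure (D.carrier \ D'.carrier))ᶜ := isClosed_closure.isOpen_compl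
  have hCl : IsClosed (D.carrier \ closure D'.carrier)ᶜ :=
    (D.isOpen.sdiff isClosed_closure).isClosed_compl
  exact hB D.carrier a b ν hν hsub _ _ hO hCl (compl_closure_diff_subset D.carrier D'.carrier) _ hlim

/-- Wiring check (an `example`, so that `KappaPin_of` stays the only theorem concluding the crux): the
registered stubs, with their tree-vocabulary types, feed the skeleton theorem as stated — this term becomes
the crux proof when the three `sorry`s above are discharged. -/
example : Summit.CriticalPhenomena.SAWScalingLimit.Theses.SAWTipEnvironment.KappaPin :=
  KappaPin_of stub_avoidanceExponent stub_sandwichPassage stub_slePin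

end Summit.CriticalPhenomena.SAWScalingLimit.Cruxes.KappaPin.Birth

end
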